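import Summits.QuantumFields.YangMills.Theorems.LuscherReductionTwistedTraceScalingMehlerGap
import Summits.QuantumFields.YangMills.Theorems.LuscherReductionTwistedTraceScalingMehlerScaling
import HarnessLib

/-!
# R60 — THE STIFF CONSTANT OF (B-ST) HAS A CEILING: lane A's Mehler gap is SHARP at `ρ = max_k r_k`, so `θ₀ ≤ 1 − mehlerRatio g₀(L) ≤ 2π/L + (2π/L)²`;
# there is NO `L`-uniform stiff constant in the model (the natural strengthening is false), e.g. `θ₀ = 1/2` fails for every `L ≥ 9`
(crux `LuscherReduction.TwistedTraceScaling`, stmt-QuantumFields-20203, skeleton «twolattice» rev 3, stub S-BASE, sub-target C4-CORE, brick (B-ST) = field `hST` of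
`recordAnalyticInput_of_profile` (✓ `…BTProfileRecord`); standing disprover, cycle 48; `Cruxes/TwistedTraceScaling/Disproof.lean` VERDICT 48)

Lane A's (B-ST) pen (`pub/ym-fleet/ym-luscher-20007-p1/COARSE-DESIGN.md` §24.13, §27.6) reduces `hST` — `tubeForm v ≤ (1 − θ₀)·Λ·‖v‖²_w` for admissible `v` fibrewise
`w`-orthogonal to the frozen profile — to the invariant-sector Born–Oppenheimer gap, whose fibre model is the MEHLER GAP `…MehlerGap.mehlerForm_le_gap`
(`Q(f,f) ≤ λ₀[(1−ρ)c₀(f)² + ρ‖f‖²]` for every `ρ ∈ [max_k r_k, 1]`, `r_k = b_k/(a_k+b_k+π)`) tensored with the slow kernel (`…MehlerTensorGap.abs_tensorForm_sub_slow_le`);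
the (B-ST) constant is `1 − θ₀ = ρ`, and `…MehlerScaling` normalises a lattice stiff mode of Hessian eigenvalue `w` to `r = mehlerRatio w = 2/(w + 2 + √(w²+4w))`,
naming `θ_S = 1 − mehlerRatio g₀`, `g₀ = 2 − 2cos(2π/L)`, as the design value.  This file certifies that the design value is the CEILING and prices it in `L`:
* §1 the first excited Hermite state `hR e_k` (`e_k = Finsupp.single k 1`) of mode `k`: ground coefficient `0`, unit norm, `Q(hR e_k, hR e_k) = λ₀·r_k` (lane A's
  `mehlerForm_hR_hR`);
* §2 ★★ `mehlerGap_fails_below` — for every `ρ < r_k` the gap inequality FAILS (witness `hR e_k`), in both shapes (lane A's `(1−ρ)c₀² + ρ‖f‖²` and the orthogonal-complement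
  shape `c₀(f) = 0 ⇒ Q ≤ λ₀ρ‖f‖²`); ★★ `mehlerGap_iff` — for `0 ≤ ρ ≤ 1` the gap inequality holds for all `f ∈ L²` IFF `∀ k, r_k ≤ ρ`: the admissible constants are EXACTLY
  `[max_k r_k, 1]`;
* §3 ★★ `stiffGap_le` — a stiff constant `θ` (`c₀(f) = 0 ⇒ Q(f,f) ≤ λ₀(1−θ)‖f‖²`) satisfies `θ ≤ 1 − r_k` for EVERY mode; in the lattice normalisation (`r_k = mehlerRatio w_k`,
  `…MehlerScaling.mehler_normalisation`) `θ ≤ 1 − mehlerRatio w_k` (`stiffGap_le_one_sub_mehlerRatio`);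
* §4 the size of the ceiling: `one_sub_mehlerRatio_le : 1 − mehlerRatio w ≤ √w + w`, `vacuumStiff_le : 2 − 2cos(2π/L) ≤ (2π/L)²`, hence ★★ `stiffGap_le_vacuum`: a model with a
  mode at the vacuum stiff gap `g₀(L)` has `θ ≤ 2π/L + (2π/L)²`;
* §5 ★★★ `no_uniform_stiffGap` — the NATURAL STRENGTHENING "one `θ₀ > 0` for all `L`" is FALSE in the model: for every `θ > 0` there is `L₀` (`= ⌈13/θ⌉₊ + 7`) such that for
  all `L ≥ L₀` and EVERY normalised Mehler datum containing a mode at `g₀(L)`, some ground-orthogonal `f ∈ L²` has `Q(f,f) > λ₀(1−θ)‖f‖²`;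
* §6 concrete: `mehlerRatio_gt_half` (`w < 1/2 ⇒ r(w) > 1/2`), `vacuumStiff_lt_half` (`L ≥ 9 ⇒ g₀(L) < 1/2`), ★ `stiffGap_half_fails`: `θ₀ = 1/2` is inadmissible for every
  `L ≥ 9`.

READING (disprover's ledger, cycle 48).  (i) The physical competitor behind §2 is the colour-CHARGED first stiff excitation `n(u)·z_k ⊗ Ω_c` (adjoint slow factor × adjoint
linear stiff factor: jointly `Ad`-invariant, fibre-orthogonal to the colour-blind `Ω_c` by parity, tube Rayleigh quotient `r(g₀)·Λ·(1 − o(1))`), so the ceiling is not an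
artefact of the model: (B-ST) must be filed with `θ₀ = θ₀(L) < 1 − mehlerRatio g₀(L)`, and since S-BASE (`Stmt.stub_fixedLatticeTraceLaw`) quantifies over EVERY fixed `L₁`, no
absolute constant survives (`1/2` dies at `L₁ = 9`); the Feshbach absorption `b² ≤ ε·θ₀·λ_b/16` of `SoftTubeBOPackageAt` inherits the factor `θ₀(L) = O(1/L)` — harmless at
fixed `L₁` (b² = Õ(β^{-2s}) = o(λ_b) for `s > 1/6`, R58), recorded so that no later file posits an `L`-free `θ₀`.  (ii) The two other (B-ST) probes of this cycle found NO bite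
and are NOT typed here: the gauge profile of `frozenProfile` is matched EXACTLY to the record weight (lane A's `frozenProfile_mul_softWeight_orthoTube`), so the rank-one
gauge-sector ceiling `θ₀ ≤ 2 − 1/κ²` is vacuous (`κ = 1`; a mismatched profile is already dead by R40 with un-captured fraction `1 − κ²`); the slow-point dependence of the
fibre ground state costs capture `O(β^{-2s})`, below R58's off-diagonal floor `β^{-s}`, consistent with R40.  Nothing here refutes a landed file.
HONEST FRAMING: `L²` spectral bookkeeping (Hermite eigenfunctions of the Mehler kernel) about the constant of one brick of a stub of a child of the CONDITIONAL reduction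
route R2b1 (bears on R2b1 only); not `¬TwistedTraceScaling`, not infinite volume, not a mass gap, not Clay.

## References
* A. Wipf, *Statistical Approach to Quantum Field Theory*, LNP 992, Springer 2021, §8.5.1 (8.57)–(8.58). [Wipf2021]
* G. B. Folland, *Harmonic Analysis in Phase Space*, Princeton UP 1989, §1.7 (vii). [Folland1989]
* M. Lüscher, *Some analytic results concerning the mass spectrum of Yang–Mills gauge theories on a torus*, Nucl. Phys. B219 (1983) 233–261, §3. [Luscher1983]
-/

set_option autoImplicit false

noncomputable section

open MeasureTheory Real Filter Topology
open scoped BigOperators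

namespace Summit.QuantumFields.YangMills.Theorems.TwistedTraceScaling.Negative.R60

open Summit.QuantumFields.YangMills.Theorems.FemtoTransferGap.Mehler

variable {σ : Type*} [Fintype σ] [DecidableEq σ]

/-! ## §1 The first excited Hermite state of a stiff mode -/

/-- `Π_j r_j^{(e_k)_j} = r_k`. [folklore] -/
theorem prod_pow_single (r : σ → ℝ) (k : σ) : ∏ j, r j ^ ((Finsupp.single k 1 : σ →₀ ℕ) j) = r k := by
  have h : ∀ j, r j ^ ((Finsupp.single k 1 : σ →₀ ℕ) j) = if k = j then r j else 1 := fun j => by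
    rw [Finsupp.single_apply]
    split_ifs <;> simp
  simp_rw [h]
  rw [Finset.prod_ite_eq]; simp

omit [Fintype σ] [DecidableEq σ] in
/-- `e_k ≠ 0`. [folklore] -/
theorem single_one_ne_zero (k : σ) : (Finsupp.single k 1 : σ →₀ ℕ) ≠ 0 := Finsupp.single_ne_zero.mpr one_ne_zero

/-- The first excited state of mode `k` has no ground component: `c₀(hR e_k) = 0`. [cite: Folland1989, §1.7 (vii)] -/
theorem hermCoeff_hR_single_zero (k : σ) : hermCoeff (hR (Finsupp.single k 1 : σ →₀ ℕ)) 0 = 0 := by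
  unfold hermCoeff
  rw [integral_hR_mul_hR, if_neg (single_one_ne_zero k)]

/-- Unit norm: `∫ (hR α)² = 1`. [cite: Folland1989, §1.7 (vii)] -/
theorem integral_hR_sq (α : σ →₀ ℕ) : ∫ x, hR α x ^ 2 = 1 := by
  have h := integral_hR_mul_hR (σ := σ) α α
  rw [if_pos rfl] at h
  rw [← h]
  exact integral_congr_ae (ae_of_all _ fun x => by simp [sq])

/-- `Q(hR e_k, hR e_k) = λ₀ · r_k`. [cite: Wipf2021, §8.5.1 (8.58)] -/
theorem mehlerForm_hR_single {a b : σ → ℝ} (hs : ∀ j, 0 < a j + b j + π) (hab : ∀ j, a j ^ 2 + 2 * a j * b j = π ^ 2) (k : σ) :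
    mehlerForm a b (hR (Finsupp.single k 1 : σ →₀ ℕ)) (hR (Finsupp.single k 1 : σ →₀ ℕ)) =
      (∏ j, Real.sqrt (π / (a j + b j + π))) * (b k / (a k + b k + π)) := by
  rw [mehlerForm_hR_hR hs hab, if_pos rfl, prod_pow_single (fun j => b j / (a j + b j + π)) k]

omit [DecidableEq σ] in
/-- Positivity of the data: `0 < a_j + b_j + π`, `0 < λ₀`, `0 < r_k`. [folklore] -/
theorem data_pos {a b : σ → ℝ} (ha : ∀ j, 0 < a j) (hb : ∀ j, 0 < b j) :
    (∀ j, 0 < a j + b j + π) ∧ 0 < ∏ j, Real.sqrt (π / (a j + b j + π)) ∧ ∀ k, 0 < b k / (a k + b k + π) := by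
  have hs : ∀ j, 0 < a j + b j + π := fun j => by have := Real.pi_pos; linarith [ha j, hb j]
  refine ⟨hs, Finset.prod_pos fun j _ => Real.sqrt_pos.mpr (div_pos Real.pi_pos (hs j)), fun k => div_pos (hb k) (hs k)⟩

/-! ## §2 ★★ Sharpness of the Mehler gap: the admissible constants are exactly `[max_k r_k, 1]` -/

/-- ★★ **The gap inequality fails below `r_k`** (lane A's shape): for `ρ < r_k = b_k/(a_k+b_k+π)` it is FALSE that every `f ∈ L²` obeys
`Q(f,f) ≤ λ₀[(1−ρ)c₀(f)² + ρ‖f‖²]` — the first excited state `hR e_k` has `c₀ = 0`, `‖·‖ = 1` and `Q = λ₀ r_k > λ₀ ρ`. [cite: Wipf2021, §8.5.1 (8.58)] -/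
theorem mehlerGap_fails_below {a b : σ → ℝ} (ha : ∀ j, 0 < a j) (hb : ∀ j, 0 < b j) (hab : ∀ j, a j ^ 2 + 2 * a j * b j = π ^ 2)
    {ρ : ℝ} (k : σ) (hρ : ρ < b k / (a k + b k + π)) :
    ¬ ∀ f : (σ → ℝ) → ℝ, MemLp f 2 (volume : Measure (σ → ℝ)) →
      mehlerForm a b f f ≤ (∏ j, Real.sqrt (π / (a j + b j + π))) * ((1 - ρ) * hermCoeff f 0 ^ 2 + ρ * ∫ x, f x ^ 2) := by
  obtain ⟨hs, hL, -⟩ := data_pos ha hb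
  intro h
  have hf := h (hR (Finsupp.single k 1 : σ →₀ ℕ)) (memLp_hR _)
  rw [mehlerForm_hR_single hs hab k, hermCoeff_hR_single_zero, integral_hR_sq] at hf
  have : (∏ j, Real.sqrt (π / (a j + b j + π))) * (b k / (a k + b k + π)) ≤ (∏ j, Real.sqrt (π / (a j + b j + π))) * ρ := by
    simpa using hf
  exact absurd this (not_le.mpr (mul_lt_mul_of_pos_left hρ hL))

/-- ★★ **The same on the orthogonal complement of the ground state**: for `ρ < r_k` it is FALSE that every `f ∈ L²` with `c₀(f) = 0` obeys `Q(f,f) ≤ λ₀ρ‖f‖²`.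
[cite: Wipf2021, §8.5.1 (8.58)] -/
theorem mehlerGap_orth_fails_below {a b : σ → ℝ} (ha : ∀ j, 0 < a j) (hb : ∀ j, 0 < b j) (hab : ∀ j, a j ^ 2 + 2 * a j * b j = π ^ 2)
    {ρ : ℝ} (k : σ) (hρ : ρ < b k / (a k + b k + π)) :
    ¬ ∀ f : (σ → ℝ) → ℝ, MemLp f 2 (volume : Measure (σ → ℝ)) → hermCoeff f 0 = 0 →
      mehlerForm a b f f ≤ (∏ j, Real.sqrt (π / (a j + b j + π))) * ρ * ∫ x, f x ^ 2 := by
  obtain ⟨hs, hL, -⟩ := data_pos ha hb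
  intro h
  have hf := h (hR (Finsupp.single k 1 : σ →₀ ℕ)) (memLp_hR _) (hermCoeff_hR_single_zero k)
  rw [mehlerForm_hR_single hs hab k, integral_hR_sq, mul_one] at hf
  exact absurd hf (not_le.mpr (mul_lt_mul_of_pos_left hρ hL))

/-- ★★ **Characterisation of the admissible constants.**  For `0 ≤ ρ ≤ 1`: lane A's gap inequality holds for every real `f ∈ L²` IFF `r_k ≤ ρ` for every mode `k` — the
admissible set is exactly `[max_k r_k, 1]` (`⇐` is `…MehlerGap.mehlerForm_le_gap`, `⇒` is `mehlerGap_fails_below`). [cite: Wipf2021, §8.5.1 (8.58)] [cite: Folland1989, §1.7 (vii)] -/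
theorem mehlerGap_iff {a b : σ → ℝ} (ha : ∀ j, 0 < a j) (hb : ∀ j, 0 < b j) (hab : ∀ j, a j ^ 2 + 2 * a j * b j = π ^ 2)
    {ρ : ℝ} (hρ0 : 0 ≤ ρ) (hρ1 : ρ ≤ 1) :
    (∀ f : (σ → ℝ) → ℝ, MemLp f 2 (volume : Measure (σ → ℝ)) →
      mehlerForm a b f f ≤ (∏ j, Real.sqrt (π / (a j + b j + π))) * ((1 - ρ) * hermCoeff f 0 ^ 2 + ρ * ∫ x, f x ^ 2)) ↔
    ∀ k, b k / (a k + b k + π) ≤ ρ := by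
  constructor
  · intro h k
    by_contra hk
    exact mehlerGap_fails_below ha hb hab k (not_le.mp hk) h
  · intro hρ f hf
    exact mehlerForm_le_gap ha hb hab hρ0 hρ hρ1 hf

/-! ## §3 ★★ The ceiling of a stiff constant -/

/-- ★★ **Every stiff constant is at most `1 − r_k` for every mode.**  If `θ` is a stiff constant of the Mehler datum `(a, b)` — every ground-orthogonal `f ∈ L²` has
`Q(f,f) ≤ λ₀(1−θ)‖f‖²` — then `θ ≤ 1 − r_k` for EVERY `k`. [cite: Wipf2021, §8.5.1 (8.58)] -/
theorem stiffGap_le {a b : σ → ℝ} (ha : ∀ j, 0 < a j) (hb : ∀ j, 0 < b j) (hab : ∀ j, a j ^ 2 + 2 * a j * b j = π ^ 2) {θ : ℝ}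
    (hgap : ∀ f : (σ → ℝ) → ℝ, MemLp f 2 (volume : Measure (σ → ℝ)) → hermCoeff f 0 = 0 →
      mehlerForm a b f f ≤ (∏ j, Real.sqrt (π / (a j + b j + π))) * (1 - θ) * ∫ x, f x ^ 2) (k : σ) :
    θ ≤ 1 - b k / (a k + b k + π) := by
  by_contra hθ
  exact mehlerGap_orth_fails_below ha hb hab k (by linarith [not_le.mp hθ]) hgap

/-- ★★ **In the lattice normalisation** (`…MehlerScaling.mehler_normalisation`: a stiff mode of Hessian eigenvalue `w_k > 0` has `r_k = mehlerRatio w_k`, independently of `β`):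
a stiff constant satisfies `θ ≤ 1 − mehlerRatio w_k` for every mode. [cite: Wipf2021, §8.5.1 (8.57)] -/
theorem stiffGap_le_one_sub_mehlerRatio {a b : σ → ℝ} (ha : ∀ j, 0 < a j) (hb : ∀ j, 0 < b j) (hab : ∀ j, a j ^ 2 + 2 * a j * b j = π ^ 2) {θ : ℝ}
    (hgap : ∀ f : (σ → ℝ) → ℝ, MemLp f 2 (volume : Measure (σ → ℝ)) → hermCoeff f 0 = 0 →
      mehlerForm a b f f ≤ (∏ j, Real.sqrt (π / (a j + b j + π))) * (1 - θ) * ∫ x, f x ^ 2)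
    {w : σ → ℝ} (hnorm : ∀ k, b k / (a k + b k + π) = mehlerRatio (w k)) (k : σ) : θ ≤ 1 - mehlerRatio (w k) := by
  rw [← hnorm k]; exact stiffGap_le ha hb hab hgap k

/-! ## §4 The size of the ceiling: `1 − mehlerRatio g₀(L) ≤ 2π/L + (2π/L)²` -/

/-- `1 − r(w) ≤ √w + w` for `w ≥ 0` (`1 − r = (w + √(w²+4w))/(w + 2 + √(w²+4w)) ≤ (w + √(w²+4w))/2` and `√(w²+4w) ≤ w + 2√w`). [folklore] -/
theorem one_sub_mehlerRatio_le {w : ℝ} (hw : 0 ≤ w) : 1 - mehlerRatio w ≤ Real.sqrt w + w := by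
  unfold mehlerRatio
  set s := Real.sqrt (w ^ 2 + 4 * w) with hs_def
  have hs0 : 0 ≤ s := Real.sqrt_nonneg _
  have hs2 : s ^ 2 = w ^ 2 + 4 * w := Real.sq_sqrt (by positivity)
  have hq0 : 0 ≤ Real.sqrt w := Real.sqrt_nonneg _
  have hq2 : Real.sqrt w ^ 2 = w := Real.sq_sqrt hw
  -- `s ≤ w + 2√w`
  have hs_le : s ≤ w + 2 * Real.sqrt w := by
    have h1 : w ^ 2 + 4 * w ≤ (w + 2 * Real.sqrt w) ^ 2 := by nlinarith [hq2, mul_nonneg hw hq0]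
    calc s = Real.sqrt (w ^ 2 + 4 * w) := rfl
      _ ≤ Real.sqrt ((w + 2 * Real.sqrt w) ^ 2) := Real.sqrt_le_sqrt h1
      _ = w + 2 * Real.sqrt w := Real.sqrt_sq (by positivity)
  have hden : 0 < w + 2 + s := by positivity
  have hne : w + 2 + s ≠ 0 := hden.ne'
  rw [show 1 - 2 / (w + 2 + s) = (w + s) / (w + 2 + s) by field_simp; ring]
  rw [div_le_iff₀ hden]
  nlinarith [mul_nonneg hw hs0, mul_nonneg hq0 hs0, mul_nonneg hw hq0, sq_nonneg s, hq2]

/-- The vacuum stiff gap is at most `(2π/L)²`: `2 − 2cos(2π/L) ≤ (2π/L)²`. [folklore] -/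
theorem vacuumStiff_le (L : ℝ) : 2 - 2 * Real.cos (2 * π / L) ≤ (2 * π / L) ^ 2 := by
  have h := Real.one_sub_sq_div_two_le_cos (x := 2 * π / L)
  linarith

/-- `0 ≤ 2 − 2cos(2π/L)`. [folklore] -/
theorem vacuumStiff_nonneg (L : ℝ) : 0 ≤ 2 - 2 * Real.cos (2 * π / L) := by
  linarith [Real.cos_le_one (2 * π / L)]

/-- `1 − mehlerRatio g₀(L) ≤ 2π/L + (2π/L)²` for `L > 0`. [folklore] -/
theorem one_sub_mehlerRatio_vacuum_le {L : ℝ} (hL : 0 < L) :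
    1 - mehlerRatio (2 - 2 * Real.cos (2 * π / L)) ≤ 2 * π / L + (2 * π / L) ^ 2 := by
  have h0 := vacuumStiff_nonneg L
  have h1 := vacuumStiff_le L
  have hx : 0 ≤ 2 * π / L := by positivity
  have hsq : Real.sqrt (2 - 2 * Real.cos (2 * π / L)) ≤ 2 * π / L :=
    calc Real.sqrt (2 - 2 * Real.cos (2 * π / L)) ≤ Real.sqrt ((2 * π / L) ^ 2) := Real.sqrt_le_sqrt h1
      _ = 2 * π / L := Real.sqrt_sq hx
  linarith [one_sub_mehlerRatio_le h0]

/-- ★★ **The ceiling at the vacuum stiff gap.**  If the Mehler datum contains a mode `k₀` normalised at the vacuum stiff gap `g₀(L) = 2 − 2cos(2π/L)` (`L > 0`), every stiff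
constant satisfies `θ ≤ 2π/L + (2π/L)²`. [cite: Wipf2021, §8.5.1 (8.57)] [cite: Luscher1983, §3] -/
theorem stiffGap_le_vacuum {a b : σ → ℝ} (ha : ∀ j, 0 < a j) (hb : ∀ j, 0 < b j) (hab : ∀ j, a j ^ 2 + 2 * a j * b j = π ^ 2) {θ : ℝ}
    (hgap : ∀ f : (σ → ℝ) → ℝ, MemLp f 2 (volume : Measure (σ → ℝ)) → hermCoeff f 0 = 0 →
      mehlerForm a b f f ≤ (∏ j, Real.sqrt (π / (a j + b j + π))) * (1 - θ) * ∫ x, f x ^ 2)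
    {L : ℝ} (hL : 0 < L) (k₀ : σ) (hk₀ : b k₀ / (a k₀ + b k₀ + π) = mehlerRatio (2 - 2 * Real.cos (2 * π / L))) :
    θ ≤ 2 * π / L + (2 * π / L) ^ 2 := by
  have h := stiffGap_le ha hb hab hgap k₀
  rw [hk₀] at h
  linarith [one_sub_mehlerRatio_vacuum_le hL]

/-! ## §5 ★★★ No `L`-uniform stiff constant -/

/-- Arithmetic of the threshold: for `θ > 0`, `L₀ = ⌈13/θ⌉₊ + 7` and real `L ≥ L₀`: `2π/L + (2π/L)² < θ`. [folklore] -/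
theorem threshold_lt {θ : ℝ} (hθ : 0 < θ) {L : ℝ} (hL : ((⌈13 / θ⌉₊ + 7 : ℕ) : ℝ) ≤ L) : 2 * π / L + (2 * π / L) ^ 2 < θ := by
  have hpi := Real.pi_lt_d2
  have hpi0 := Real.pi_pos
  have hceil : 13 / θ ≤ (⌈13 / θ⌉₊ : ℝ) := Nat.le_ceil _
  push_cast at hL
  have hL13 : 13 / θ ≤ L := by linarith
  have hL7 : (7 : ℝ) ≤ L := by
    have : 0 ≤ (⌈13 / θ⌉₊ : ℝ) := Nat.cast_nonneg _
    linarith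
  have hL0 : 0 < L := by linarith
  set x := 2 * π / L with hx
  have hx0 : 0 ≤ x := by positivity
  -- `x ≤ 2π/7 < 1`, so `x² ≤ x`
  have hx1 : x ≤ 1 := by
    rw [hx, div_le_iff₀ hL0]; linarith
  have hxx : x ^ 2 ≤ x := by nlinarith
  -- `2x = 4π/L ≤ 4πθ/13 < θ`
  have h2x : 2 * x < θ := by
    have hθL : 13 ≤ θ * L := by
      have h := mul_le_mul_of_nonneg_left hL13 hθ.le
      have h13 : θ * (13 / θ) = 13 := by field_simp
      linarith
    rw [hx, show 2 * (2 * π / L) = 4 * π / L by ring, div_lt_iff₀ hL0]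
    linarith
  linarith

/-- ★★★ **NO `L`-UNIFORM STIFF CONSTANT.**  For every `θ > 0` there is `L₀` (`= ⌈13/θ⌉₊ + 7`) such that for every `L ≥ L₀`, every finite mode set `ι` and every normalised
Mehler datum `(a, b)` on it (`0 < a, b`, `a² + 2ab = π²`) containing a mode `k₀` at the vacuum stiff gap, `r_{k₀} = mehlerRatio (2 − 2cos(2π/L))`, the stiff inequality with
constant `θ` FAILS: some ground-orthogonal `f ∈ L²(ℝ^ι)` has `Q(f,f) > λ₀(1−θ)‖f‖²`.  (The strengthening of (B-ST) to an `L`-independent `θ₀` is false in its own model.)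
[cite: Wipf2021, §8.5.1 (8.58)] [cite: Luscher1983, §3] -/
theorem no_uniform_stiffGap {θ : ℝ} (hθ : 0 < θ) :
    ∃ L₀ : ℕ, ∀ L : ℕ, L₀ ≤ L → ∀ (ι : Type) [Fintype ι] [DecidableEq ι] (a b : ι → ℝ),
      (∀ j, 0 < a j) → (∀ j, 0 < b j) → (∀ j, a j ^ 2 + 2 * a j * b j = π ^ 2) →
      ∀ k₀ : ι, b k₀ / (a k₀ + b k₀ + π) = mehlerRatio (2 - 2 * Real.cos (2 * π / L)) →
      ¬ ∀ f : (ι → ℝ) → ℝ, MemLp f 2 (volume : Measure (ι → ℝ)) → hermCoeff f 0 = 0 →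
        mehlerForm a b f f ≤ (∏ j, Real.sqrt (π / (a j + b j + π))) * (1 - θ) * ∫ x, f x ^ 2 := by
  refine ⟨⌈13 / θ⌉₊ + 7, fun L hL ι _ _ a b ha hb hab k₀ hk₀ hgap => ?_⟩
  have hLr : ((⌈13 / θ⌉₊ + 7 : ℕ) : ℝ) ≤ (L : ℝ) := by exact_mod_cast hL
  have hLpos : 0 < (L : ℝ) := by
    have : (7 : ℝ) ≤ ((⌈13 / θ⌉₊ + 7 : ℕ) : ℝ) := by push_cast; linarith [(Nat.cast_nonneg _ : (0 : ℝ) ≤ ⌈13 / θ⌉₊)]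
    linarith
  have h1 := stiffGap_le_vacuum ha hb hab hgap hLpos k₀ hk₀
  have h2 := threshold_lt hθ hLr
  linarith

/-! ## §6 Concrete: `θ₀ = 1/2` is inadmissible for every `L ≥ 9` -/

/-- `w < 1/2 ⇒ mehlerRatio w > 1/2` (`0 ≤ w`). [folklore] -/
theorem mehlerRatio_gt_half {w : ℝ} (hw0 : 0 ≤ w) (hw : w < 1 / 2) : 1 / 2 < mehlerRatio w := by
  unfold mehlerRatio
  have hs : Real.sqrt (w ^ 2 + 4 * w) < 2 - w := by
    rw [Real.sqrt_lt' (by linarith)]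
    nlinarith
  have hden : 0 < w + 2 + Real.sqrt (w ^ 2 + 4 * w) := by positivity
  rw [lt_div_iff₀ hden]
  linarith

/-- `L ≥ 9 ⇒ g₀(L) = 2 − 2cos(2π/L) < 1/2` (`cos(2π/9) ≥ 1 − (2π/9)²/2 > 3/4`). [folklore] -/
theorem vacuumStiff_lt_half {L : ℝ} (hL : 9 ≤ L) : 2 - 2 * Real.cos (2 * π / L) < 1 / 2 := by
  have hpi := Real.pi_lt_d2
  have hpi0 := Real.pi_pos
  have hL0 : 0 < L := by linarith
  have h1 := vacuumStiff_le L
  have hx : 2 * π / L ≤ 2 * π / 9 := div_le_div_of_nonneg_left (by positivity) (by norm_num) hL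
  have hx0 : 0 ≤ 2 * π / L := by positivity
  have hsq : (2 * π / L) ^ 2 ≤ (2 * π / 9) ^ 2 := by
    have h := mul_le_mul hx hx hx0 (hx0.trans hx)
    simpa only [sq] using h
  have h9 : (2 * π / 9) ^ 2 < 1 / 2 := by
    rw [div_pow, div_lt_iff₀ (by norm_num)]; nlinarith [mul_pos hpi0 hpi0]
  linarith

/-- ★ **`θ₀ = 1/2` fails for every `L ≥ 9`.**  A normalised Mehler datum containing a mode at the vacuum stiff gap of a lattice of side `L ≥ 9` admits NO stiff constant
`θ ≥ 1/2`: some ground-orthogonal `f` has `Q(f,f) > (λ₀/2)‖f‖²`. [cite: Wipf2021, §8.5.1 (8.58)] [cite: Luscher1983, §3] -/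
theorem stiffGap_half_fails {a b : σ → ℝ} (ha : ∀ j, 0 < a j) (hb : ∀ j, 0 < b j) (hab : ∀ j, a j ^ 2 + 2 * a j * b j = π ^ 2)
    {L : ℝ} (hL : 9 ≤ L) (k₀ : σ) (hk₀ : b k₀ / (a k₀ + b k₀ + π) = mehlerRatio (2 - 2 * Real.cos (2 * π / L))) {θ : ℝ} (hθ : 1 / 2 ≤ θ) :
    ¬ ∀ f : (σ → ℝ) → ℝ, MemLp f 2 (volume : Measure (σ → ℝ)) → hermCoeff f 0 = 0 →
      mehlerForm a b f f ≤ (∏ j, Real.sqrt (π / (a j + b j + π))) * (1 - θ) * ∫ x, f x ^ 2 := by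
  intro hgap
  have h := stiffGap_le ha hb hab hgap k₀
  rw [hk₀] at h
  have hr := mehlerRatio_gt_half (vacuumStiff_nonneg L) (vacuumStiff_lt_half hL)
  linarith

end Summit.QuantumFields.YangMills.Theorems.TwistedTraceScaling.Negative.R60

end
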